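import Literature.AlgebraicGeometry.Resolution.AbhyankarValuationsLocalUniformization
import Literature.AlgebraicGeometry.Resolution.LocalReductionOfMultiplicity
import HarnessLib

/-!
# The open core of local uniformization in positive characteristic: positive transcendence defect

Topic: `Literature/AlgebraicGeometry/Resolution`. Bookkeeping for the dimension-`4` obstruction
census of the cell `pub-hironaka` (unit `b2b-hironaka-cp4`, `OBSTRUCTIONS-DIM4.md` §12.8 "the
open core of LU₄"), kernel-checked over results the tree already PROVES:

* Knaf–Kuhlmann 2005, Thm. 1.1 (Ann. Sci. ÉNS 38: "every place `P` of an algebraic function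
  field `F|K` of arbitrary characteristic admits local uniformization, provided that the sum of
  the rational rank of its value group and the transcendence degree of its residue field `FP`
  over `K` is equal to the transcendence degree of `F|K`, and the extension `FP|K` is
  separable"), in the tree as `isLocallyUniformizable_of_transcendenceDefect_eq_zero` (over a
  PERFECT ground field, from the discharged `Temkin2013Abhyankar_holds`; file
  `AbhyankarValuationsLocalUniformization.lean`).

Consequently the tree's local-uniformization problems — `LocalUniformizationInChar p` (every
field of characteristic `p`) and Cutkosky–Mourtada's `LUInDim m` ("LU holds in dimension `m`",
algebraically closed ground field, `LocalReductionOfMultiplicity.lean`) — are EQUIVALENT to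
their restrictions to valuations of POSITIVE transcendence defect (`E + F < tr.deg`), the
Abhyankar valuations (`E + F = tr.deg`) over perfect fields being settled. For the census:
`LUInDim 4` (= `LU₄` of Cutkosky–Mourtada 2019 §1, "we do not know ELU in dimension 4, so we
are unable to proceed to LU in dimension 4") is open exactly at valuations of 4-dimensional
function fields with `E + F ≤ 3` (`luInDim_four_iff_posDefect`); the further printed reduction
to RANK-ONE valuations (Novacoski–Spivakovsky 2014 Thm. 1.1, tree `NovacoskiSpivakovsky2014_holds`,
stated there in the relative vocabulary `RelLocalUniformization`) is not re-rendered here.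

Nothing is asserted about `LUInDim 4`; the theorems are equivalences. No new definition.
[cite: KnafKuhlmann2005, Thm. 1.1] [cite: CutkoskyMourtada2019, §1 Def. 1.1]
-/

noncomputable section

namespace Literature.AlgebraicGeometry.Resolution

universe u

/-- **`LU_p` ⟺ `LU_p` at valuations that are not Abhyankar-over-a-perfect-field.** The
instances of `LocalUniformizationInChar p` with `k` perfect and transcendence defect `0` are
theorems (Knaf–Kuhlmann 2005, Thm. 1.1; tree `isLocallyUniformizable_of_transcendenceDefect_eq_zero`),
so the problem is equivalent to its restriction to the remaining valuations: imperfect ground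
field, or positive transcendence defect. [cite: KnafKuhlmann2005, Thm. 1.1] -/
theorem localUniformizationInChar_iff_posDefect (p : ℕ) :
    LocalUniformizationInChar.{u} p ↔
      ∀ (k K : Type u) [Field k] [CharP k p] [Field K] [Algebra k K],
        (⊤ : IntermediateField k K).FG →
        ∀ (O : ValuationSubring K) (hk : ∀ c : k, algebraMap k K c ∈ O),
          (PerfectField k → transcendenceDefect k O hk ≠ 0) → IsLocallyUniformizable k K O := by
  refine ⟨fun h k K _ _ _ _ hfg O hk _ => h k K hfg O hk, fun h k K _ _ _ _ hfg O hk => ?_⟩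
  by_cases hP : PerfectField k
  · by_cases h0 : transcendenceDefect k O hk = 0
    · exact isLocallyUniformizable_of_transcendenceDefect_eq_zero hfg O hk h0
    · exact h k K hfg O hk fun _ => h0
  · exact h k K hfg O hk fun hP' => absurd hP' hP

/-- **Cutkosky–Mourtada's "LU holds in dimension `m`" ⟺ the same for valuations of positive
transcendence defect** (`E + F < m`): over an algebraically closed (hence perfect) ground field
the Abhyankar valuations are uniformizable by Knaf–Kuhlmann 2005, Thm. 1.1.
[cite: KnafKuhlmann2005, Thm. 1.1] [cite: CutkoskyMourtada2019, §1 Def. 1.1] -/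
theorem luInDim_iff_posDefect (m : ℕ) :
    LUInDim.{u} m ↔
      ∀ (k K : Type u) [Field k] [IsAlgClosed k] [Field K] [Algebra k K],
        (⊤ : IntermediateField k K).FG → Algebra.trdeg k K = m →
        ∀ (O : ValuationSubring K) (hk : ∀ c : k, algebraMap k K c ∈ O),
          transcendenceDefect k O hk ≠ 0 → IsLocallyUniformizable k K O := by
  refine ⟨fun h k K _ _ _ _ hfg hm O hk _ => h k K hfg hm O hk,
    fun h k K _ _ _ _ hfg hm O hk => ?_⟩
  by_cases h0 : transcendenceDefect k O hk = 0
  · exact isLocallyUniformizable_of_transcendenceDefect_eq_zero hfg O hk h0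
  · exact h k K hfg hm O hk h0

/-- Positive transcendence defect on an `m`-dimensional function field means
`E + F ≤ m - 1` (`E` = rational rank, `F` = residual transcendence degree):
`D = m - E - F ≠ 0`. [cite: Temkin2013, Section 2.1 (p. 10)] -/
theorem ratRank_add_residueTrdeg_lt_of_transcendenceDefect_ne_zero {k K : Type u} [Field k]
    [Field K] [Algebra k K] (O : ValuationSubring K) (hk : ∀ c : k, algebraMap k K c ∈ O)
    (h0 : transcendenceDefect k O hk ≠ 0) :
    Cardinal.toNat (ratRank O) + Cardinal.toNat (residueTrdeg k O hk) <
      Cardinal.toNat (Algebra.trdeg k K) := by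
  unfold transcendenceDefect at h0
  omega

/-- **The open core of `LU₄`, isolated** (census `OBSTRUCTIONS-DIM4.md` §12.8): Cutkosky–
Mourtada's `LU₄` ("we are unable to proceed to LU in dimension 4", 2019 §1) is equivalent to
local uniformization of the valuations of POSITIVE transcendence defect (`E + F ≤ 3`) on
`4`-dimensional function fields over algebraically closed fields; nothing about it is asserted.
[cite: CutkoskyMourtada2019, §1 Def. 1.1] [cite: KnafKuhlmann2005, Thm. 1.1] -/
theorem luInDim_four_iff_posDefect :
    LUInDim.{u} 4 ↔
      ∀ (k K : Type u) [Field k] [IsAlgClosed k] [Field K] [Algebra k K],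
        (⊤ : IntermediateField k K).FG → Algebra.trdeg k K = 4 →
        ∀ (O : ValuationSubring K) (hk : ∀ c : k, algebraMap k K c ∈ O),
          transcendenceDefect k O hk ≠ 0 → IsLocallyUniformizable k K O :=
  luInDim_iff_posDefect 4

end Literature.AlgebraicGeometry.Resolution
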